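import Summits.QuantumFields.BalabanUV.Beta.GAN24.NoFFWordCurrentKill
import Summits.QuantumFields.BalabanUV.Beta.GAN24.DressedKernelOnCurrentStep
import Summits.QuantumFields.BalabanUV.Beta.GAN24.EEWordReduced
import Summits.QuantumFields.BalabanUV.Beta.SpineRecursiveParity

/-!
# `BalabanUV.Beta.GAN24.VHWordsZeroLatticeStep` — binder row G-an2-4 ∕ (CONV-C), W-slot CT-W, conservation law (C)∕(C)sym AT LEVELS `j + 1 ≥ 1`, 24_{j+1} of this lineage's
# note `HOME/b2b-balaban-gan24-formalise-leaf-04/g67/CSYM-LEVEL0-KERNEL-BLUEPRINT.md` §11 «NEXT» (leaf-06 g52's memo `…/leaf-06/g52/C-LEVELS-GE1.md` §17 (W9), division ASK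
# A-leaf06-g52-1): **THE `S′ ⊗ S^E` DIRECT WORD AND THE `S^E ⊗ S′` SWAP WORD OF THE DRESSED LEVEL-`(j+1)` SOURCE'S ff ZERO MODE — border sector `S′` (no ff block) on the cell
# bond, the VALUE-FUNCTION CUBIC SECTOR `S^E_{j+1} = (cE·wE_{j+1}) • e3OfK Lc G_j (SrecAt j)` on the lattice bond — VANISH BOND BY BOND AS SOON AS THE BOND-RESUMMED LEVEL-`(j+1)`
# EXIT-FACE CURRENT IS DIVERGENCE-FREE WITH ZERO CELL TOTALS** (its `Lc`-periodicity is proved here; 24 `VHWordsZeroLattice` is the level-`0` case, where the current is the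
# co-exact edge current and both properties are free)

NOT IN PRINT; OUR BOOKKEEPING ([folklore] BY NAME over this gen's `NoFFWordCurrentKill` (the generic word lemmas) and `DressedKernelOnCurrentStep` (fact (d1) at every level),
an2's `SpineRecursiveW.SpureRecAt_succ` ∕ `ValueJetGeneric` (`e3OfK`, `e3OfK_apply`, `locStencil_e3OfK`, `e3OfK_translate`), d1-leaf-10's `WardLocusRecursive` (`locStencil_SrecAt`,
`SrecAt_translate`), d1-leaf-05's `SpineRecursiveParity.trK_e3OfK_of_rows ∕ trK_SrecAt ∕ parityOdd_smul`, leaf-02's `BubbleParity` (`vertexOfK_apply_eq_zero`, `trK_vertexOfK_of_antisymm`,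
`trK_coDressKBmAt_KInvStep`, `spr_of_decays`), 15 `EEWordReduced.shiftK_dressedStep`, 26 `LayerCommutatorAntisymm.trK_unitK_coDress`, g64 `PeriodicForceMultiplier.bounded_of_periodic`;
G-an2-4 formalisation swarm, leaf prover `b2b-balaban-gan24-formalise-leaf-04`, gen 68).  HONEST FRAMING (cell contract, verbatim): «discharging `BetaPertH` makes Bałaban's UV
stability UNCONDITIONAL — a real constructive-QFT result; it is NOT the continuum limit and NOT the Clay problem.»  HONEST DEPENDENCY (verbatim): «continuum YM on T⁴ ⇐ BetaPertH ∧
nine spine estimates (0/9 proved); BetaPertH ⇐ (D1) ∧ (D4) ∧ CAP+tail; G-an2-4 gates asym, D1 and NE2/3/4.»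

WHY.  The ff zero mode of the dressed level-`(j+1)` source (`DressedSourceZeroModeWords.zmode_dressedSource_inl_inl`, every level) splits into the 18 sector words of its two
exchange words; with 23 (multiplier words) and 26 (`VH ⊗ VH`) level-free, the words that remain OPEN at `j + 1 ≥ 1` are `E ⊗ E` (leaf-06's (W1)–(W7)), `E_c ⊗ VH_{u′}` and its swap
(27's mechanism needs the level-`(j+1)` left face read), and `VH_c ⊗ E_{u′}` and its swap — THIS FILE: their vanishing is reduced to two located properties of ONE object, the
bond-resummed exit-face current `T(b,z) = Σ'_{(u′,w)} 𝟙f(w_β)·V^E_{ν,u′} z w (inl b)(inl β)` of the level-`(j+1)` cubic sector — (D) divergence-free, (Z) zero cell totals —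
DISPLAYED as hypotheses.  ENGINE (this lineage's g64 kit, `HOME/…/leaf-04/g64/outputs/words2_n3_jb1.json`, key `D2_n3_B1_jb1`, X = G; D = 2, n = 3, float64, weight 0): at level 1
that current is multiplier-free, `Lc`-periodic (1e-15), `Πᵀ_bm`-fixed (6e-16), DIVERGENCE-FREE (6e-16), leg-antisymmetric (`tL + tR` = 1e-16) and `K_mf·Πᵀ_bm T` = 9.7e-19 on scale
1.1e-2 — (D) and the kill hold numerically; (Z) follows from leaf-06 g52's `ExitFaceHalfVertexSplit` + my g63 S3C-REC + leaf-06's value-Hessian letters (route in journal l.53680;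
not typed here).

WHAT ([folklore]; generic `d`, in-block root `ρ = toSite r`, `1 ≤ Lc`, every `j`, all units `s_f s_m`, colour constants `cE cVH cΛ`; `S′` any local stencil family with zero ff block;
0 `def`, 0 cited facts, 0 `def … : Prop`, 0 sorry), with `X̃♮_{j+1} = unitK s_f s_m (coDressKBmAt ρ Lc (KInvStep Lc (j+1)))`, `S^E_{j+1} κ t = (cE·wE d Lc (j+1)) • e3OfK Lc
(coDressKBmAt ρ Lc (KInvStep Lc j)) (SrecAt d Lc ρ cE cVH cΛ j) κ t`, `V^E_{ν,u} = vertexOfK X̃♮_{j+1} Lc (unitS s_f s_m S^E_{j+1}) ν u`, `P_{μ,c} = vertexOfK X̃♮_{j+1} Lc (unitS s_f s_m S′) μ c`: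
§1 the cubic sector — `e3Sector_inr_left ∕ _inr_right` (no multiplier legs), `exists_locStencil_e3Sector`, `e3Sector_translate` (fine covariance), `e3Sector_parityOdd`,
**`unitS_e3Sector_antisymm`** (leg antisymmetry); §2 the vertex family — `vertexE_inr`, `trK_vertexE`, `vertexE_translate`; §3 the current — **`tsum_current_periodic`**
(`Lc`-periodicity of `Σ'_{(u′,w)} ρ(w)·V^E_{ν,u′} z w f g` for periodic `ρ`), `current_bounded`; §4 the words — **`tsum_noFF_left_E_right_word_eq_zero_succ`** (DIRECT, per bond `c`,
hypotheses `hT : Σ' … = T b z`, `hdiv : Σ_b (T b p − T b (p − e_b)) = 0`, `h0 : Σ_{r′∈box} T b (toSite r′) = 0`), **`tsum_E_left_noFF_right_swap_word_eq_zero_succ`** (SWAP, the same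
with the current read at the leg `inl α`).  Asserts NO value of Bałaban's tables beyond an2's ∕ an1's DEFINED ones; discharges NOTHING of (C)sym ∕ (Q-D) ∕ (Q-D-rate) ∕ «T2Shape»
∕ «T2Drift» ∕ (hW, hWall); NEVER «G-an2-4 closed» as (CONV-C); NOT D1, NOT `BetaPertH`, NOT continuum, NOT Clay.  2026-08-23; no existing file touched.
-/

noncomputable section

open Finset
open scoped BigOperators
open Literature.MathematicalPhysics.QuantumFieldTheory
open Literature.MathematicalPhysics.QuantumFieldTheory.Balaban1983to89
open Literature.MathematicalPhysics.QuantumFieldTheory.Balaban1983to89.Beta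
open B12Sec2to5 (l1)
open ExpKernelCalculus (Site MKer comp shiftK Decays BiLoc VertexFamily)
open OneStepResolventKernel (Fib LocStencil decays_mono biLoc_mono)
open OneStepKernelFamily (KInvStep vertexOfK vertexFamily_vertexOfK decays_KInvStep vertexOfK_translate)
open StepJetData (locStencil_smul)
open BalabanStepJetsSucc (mmRead_inr_left mmRead_inr_right wE)
open AffineAveraging (Form1 box toSite unitVec)
open Summit.QuantumFields.BalabanUV.Beta.TameKernelCalculus (trK trK_apply)
open Summit.QuantumFields.BalabanUV.Beta.BorderedHessian (sgnK sgnK_apply sgnF_inl sgnF_inr)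
open Summit.QuantumFields.BalabanUV.Beta.AxialDressingRooted (coDressKBmAt decays_coDressKBmAt_KInvStep shiftK_coDressKBmAt_KInvStep)
open Summit.QuantumFields.BalabanUV.Beta.HessKerDressedUnits (unitK unitS unitS_apply decays_unitK locStencil_unitS legScale_inl legScale_inr)
open Summit.QuantumFields.BalabanUV.Beta.SpineRooted (e3OfK e3OfK_apply locStencil_e3OfK e3OfK_translate)
open Summit.QuantumFields.BalabanUV.Beta.WardLocusRecursive (SrecAt locStencil_SrecAt SrecAt_translate)
open Summit.QuantumFields.BalabanUV.Beta.SpineRecursiveParity (trK_e3OfK_of_rows trK_SrecAt parityOdd_smul)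
open Summit.QuantumFields.BalabanUV.Beta.BubbleParity (vertexOfK_apply_eq_zero trK_vertexOfK_of_antisymm trK_coDressKBmAt_KInvStep spr_of_decays)
open Summit.QuantumFields.BalabanUV.Beta.GAN24.EEWordReduced (shiftK_dressedStep)
open Summit.QuantumFields.BalabanUV.Beta.GAN24.ExchangeSlotResum (face_weight_periodic)
open Summit.QuantumFields.BalabanUV.Beta.GAN24.LayerCommutatorAntisymm (trK_unitK_coDress)
open Summit.QuantumFields.BalabanUV.Beta.GAN24.PeriodicForceMultiplier (bounded_of_periodic)
open Summit.QuantumFields.BalabanUV.Beta.GAN24.NoFFWordCurrentKill (tsum_noFF_left_right_word_eq_zero_of_current tsum_left_right_noFF_swap_word_eq_zero_of_current)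
open Summit.QuantumFields.BalabanUV.Beta.GAN24.DressedKernelOnCurrentStep (tsum_dressedStep_inr_mul_current)
open Summit.QuantumFields.BalabanUV.Beta.GAN24.VHWordsZeroLattice (vertexOfK_unitS_noFF_inl_inl)

namespace Summit.QuantumFields.BalabanUV.Beta.GAN24.VHWordsZeroLatticeStep

variable {d : ℕ} {Lc : ℕ} [NeZero Lc] {r : Fin (d + 1) → ℕ}

/-! ## §1 The level-`(j+1)` cubic sector `S^E_{j+1} = (cE·wE_{j+1}) • e3OfK Lc G_j (SrecAt j)` -/

section Sector

/-- [folklore] The value-function cubic sector has no multiplier FIRST legs (`e3OfK = −mmRead(…)` lives on the ff block). -/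
theorem e3Sector_inr_left (cE cVH cΛ : ℝ) (j : ℕ) (κ : Fin (d + 1)) (t x z : Site (d + 1)) (m : Fin (d + 1)) (b : Fib d) :
    ((cE * wE d Lc (j + 1)) • e3OfK Lc (coDressKBmAt (toSite r) Lc (KInvStep (d := d) Lc j)) (SrecAt d Lc (toSite r) cE cVH cΛ j) κ t) x z (Sum.inr m) b = 0 := by
  simp only [Pi.smul_apply, smul_eq_mul, e3OfK_apply, mmRead_inr_left, neg_zero, mul_zero]

/-- [folklore] The value-function cubic sector has no multiplier SECOND legs. -/
theorem e3Sector_inr_right (cE cVH cΛ : ℝ) (j : ℕ) (κ : Fin (d + 1)) (t x z : Site (d + 1)) (a : Fib d) (m : Fin (d + 1)) :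
    ((cE * wE d Lc (j + 1)) • e3OfK Lc (coDressKBmAt (toSite r) Lc (KInvStep (d := d) Lc j)) (SrecAt d Lc (toSite r) cE cVH cΛ j) κ t) x z a (Sum.inr m) = 0 := by
  simp only [Pi.smul_apply, smul_eq_mul, e3OfK_apply, mmRead_inr_right, neg_zero, mul_zero]

/-- [folklore] **THE CUBIC SECTOR IS A LOCAL STENCIL FAMILY** (`locStencil_e3OfK` over `locStencil_SrecAt` and the decay of the dressed step kernel). -/
theorem exists_locStencil_e3Sector (hLc : 1 ≤ Lc) (hr : r ∈ box (d + 1) Lc) (cE cVH cΛ : ℝ) (j : ℕ) :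
    ∃ C δ : ℝ, 0 < δ ∧ LocStencil (fun κ t => (cE * wE d Lc (j + 1)) • e3OfK Lc (coDressKBmAt (toSite r) Lc (KInvStep (d := d) Lc j)) (SrecAt d Lc (toSite r) cE cVH cΛ j) κ t) C δ := by
  obtain ⟨Cs, δs, hδs, hS⟩ := locStencil_SrecAt (d := d) hLc hr cE cVH cΛ j
  obtain ⟨C, δ, hδ, hV⟩ := locStencil_e3OfK (N := Lc) hLc (decays_coDressKBmAt_KInvStep (d := d) hr j) hS hδs
  exact ⟨_, δ, hδ, locStencil_smul (cE * wE d Lc (j + 1)) hV⟩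

/-- [folklore] **THE CUBIC SECTOR IS FINE-TRANSLATION COVARIANT** on the step-`(j+1)` lattice (`e3OfK_translate` with the block covariance of `G_j` and of `SrecAt j`). -/
theorem e3Sector_translate (hLc : 1 ≤ Lc) (cE cVH cΛ : ℝ) (j : ℕ) (κ : Fin (d + 1)) (u v : Site (d + 1)) :
    (fun κ t => (cE * wE d Lc (j + 1)) • e3OfK Lc (coDressKBmAt (toSite r) Lc (KInvStep (d := d) Lc j)) (SrecAt d Lc (toSite r) cE cVH cΛ j) κ t) κ (u + v) =
      shiftK (-v) ((fun κ t => (cE * wE d Lc (j + 1)) • e3OfK Lc (coDressKBmAt (toSite r) Lc (KInvStep (d := d) Lc j)) (SrecAt d Lc (toSite r) cE cVH cΛ j) κ t) κ u) := by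
  have h := e3OfK_translate (N := Lc) (K := coDressKBmAt (toSite r) Lc (KInvStep (d := d) Lc j)) (shiftK_coDressKBmAt_KInvStep (d := d) (toSite r) j)
    (S := SrecAt d Lc (toSite r) cE cVH cΛ j) (SrecAt_translate (toSite r) hLc cE cVH cΛ j) κ u v
  funext x z a b
  simp only [Pi.smul_apply, smul_eq_mul, shiftK, h]

/-- [folklore] **EVERY ROW OF THE CUBIC SECTOR IS PARITY-ODD** (d1-leaf-05's `trK_e3OfK_of_rows` over `trK_SrecAt` and the `sgnK`-symmetry of `G_j`). -/
theorem e3Sector_parityOdd (hLc : 1 ≤ Lc) (hr : r ∈ box (d + 1) Lc) (cE cVH cΛ : ℝ) (j : ℕ) (κ : Fin (d + 1)) (u : Site (d + 1)) :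
    trK ((cE * wE d Lc (j + 1)) • e3OfK Lc (coDressKBmAt (toSite r) Lc (KInvStep (d := d) Lc j)) (SrecAt d Lc (toSite r) cE cVH cΛ j) κ u) =
      -sgnK ((cE * wE d Lc (j + 1)) • e3OfK Lc (coDressKBmAt (toSite r) Lc (KInvStep (d := d) Lc j)) (SrecAt d Lc (toSite r) cE cVH cΛ j) κ u) := by
  obtain ⟨Cs, δs, hδs, hS⟩ := locStencil_SrecAt (d := d) hLc hr cE cVH cΛ j
  exact parityOdd_smul _ (trK_e3OfK_of_rows (spr_of_decays (decays_coDressKBmAt_KInvStep hr j)) (trK_coDressKBmAt_KInvStep hr j) hS hδs (trK_SrecAt hLc hr cE cVH cΛ j) κ u)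

/-- [folklore] **THE UNIT-DRESSED CUBIC SECTOR IS ANTISYMMETRIC UNDER THE EXCHANGE OF ITS TWO LEGS** (parity-odd on the ff block, zero elsewhere; the units are leg-type scalars). -/
theorem unitS_e3Sector_antisymm (hLc : 1 ≤ Lc) (hr : r ∈ box (d + 1) Lc) (sf sm cE cVH cΛ : ℝ) (j : ℕ) (κ : Fin (d + 1)) (u x z : Site (d + 1)) (a b : Fib d) :
    unitS sf sm (fun κ t => (cE * wE d Lc (j + 1)) • e3OfK Lc (coDressKBmAt (toSite r) Lc (KInvStep (d := d) Lc j)) (SrecAt d Lc (toSite r) cE cVH cΛ j) κ t) κ u z x b a =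
      -unitS sf sm (fun κ t => (cE * wE d Lc (j + 1)) • e3OfK Lc (coDressKBmAt (toSite r) Lc (KInvStep (d := d) Lc j)) (SrecAt d Lc (toSite r) cE cVH cΛ j) κ t) κ u x z a b := by
  have hpar := e3Sector_parityOdd (d := d) hLc hr cE cVH cΛ j κ u
  have h := congrFun (congrFun (congrFun (congrFun hpar x) z) a) b
  simp only [trK_apply, Pi.neg_apply, sgnK_apply] at h
  rcases a with a | m
  · rcases b with b | m'
    · simp only [unitS_apply, legScale_inl]
      rw [h, sgnF_inl, sgnF_inl]
      ring
    · simp only [unitS_apply, e3Sector_inr_left, e3Sector_inr_right, mul_zero, zero_mul, neg_zero]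
  · simp only [unitS_apply, e3Sector_inr_left, e3Sector_inr_right, mul_zero, zero_mul, neg_zero]

end Sector

/-! ## §2 The chain-rule vertex family over the cubic sector -/

section Vertex

/-- [folklore] The vertex family over the cubic sector has no multiplier first legs. -/
theorem vertexE_inr (sf sm cE cVH cΛ : ℝ) (j : ℕ) (ν : Fin (d + 1)) (u z w : Site (d + 1)) (m : Fin (d + 1)) (g : Fib d) :
    vertexOfK (unitK sf sm (coDressKBmAt (toSite r) Lc (KInvStep (d := d) Lc (j + 1)))) Lc
      (unitS sf sm (fun κ t => (cE * wE d Lc (j + 1)) • e3OfK Lc (coDressKBmAt (toSite r) Lc (KInvStep (d := d) Lc j)) (SrecAt d Lc (toSite r) cE cVH cΛ j) κ t)) ν u z w (Sum.inr m) g = 0 :=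
  vertexOfK_apply_eq_zero (a := Sum.inr m) (b := g) (fun κ' t x z' => by simp only [unitS_apply, e3Sector_inr_left, mul_zero, zero_mul]) ν u z w

/-- [folklore] The vertex family over the cubic sector is antisymmetric under the exchange of its legs. -/
theorem trK_vertexE (hLc : 1 ≤ Lc) (hr : r ∈ box (d + 1) Lc) (sf sm cE cVH cΛ : ℝ) (j : ℕ) (ν : Fin (d + 1)) (u : Site (d + 1)) :
    trK (vertexOfK (unitK sf sm (coDressKBmAt (toSite r) Lc (KInvStep (d := d) Lc (j + 1)))) Lc
      (unitS sf sm (fun κ t => (cE * wE d Lc (j + 1)) • e3OfK Lc (coDressKBmAt (toSite r) Lc (KInvStep (d := d) Lc j)) (SrecAt d Lc (toSite r) cE cVH cΛ j) κ t)) ν u) =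
      -vertexOfK (unitK sf sm (coDressKBmAt (toSite r) Lc (KInvStep (d := d) Lc (j + 1)))) Lc
        (unitS sf sm (fun κ t => (cE * wE d Lc (j + 1)) • e3OfK Lc (coDressKBmAt (toSite r) Lc (KInvStep (d := d) Lc j)) (SrecAt d Lc (toSite r) cE cVH cΛ j) κ t)) ν u :=
  trK_vertexOfK_of_antisymm (fun κ' t x z a b => unitS_e3Sector_antisymm hLc hr sf sm cE cVH cΛ j κ' t x z a b) ν u

/-- [folklore] The vertex family over the cubic sector is block-covariant (`vertexOfK_translate` with `shiftK_dressedStep` and `e3Sector_translate`). -/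
theorem vertexE_translate (hLc : 1 ≤ Lc) (sf sm cE cVH cΛ : ℝ) (j : ℕ) (ν : Fin (d + 1)) (u s : Site (d + 1)) :
    vertexOfK (unitK sf sm (coDressKBmAt (toSite r) Lc (KInvStep (d := d) Lc (j + 1)))) Lc
      (unitS sf sm (fun κ t => (cE * wE d Lc (j + 1)) • e3OfK Lc (coDressKBmAt (toSite r) Lc (KInvStep (d := d) Lc j)) (SrecAt d Lc (toSite r) cE cVH cΛ j) κ t)) ν (u + s) =
      shiftK (-((Lc : ℤ) • s)) (vertexOfK (unitK sf sm (coDressKBmAt (toSite r) Lc (KInvStep (d := d) Lc (j + 1)))) Lc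
        (unitS sf sm (fun κ t => (cE * wE d Lc (j + 1)) • e3OfK Lc (coDressKBmAt (toSite r) Lc (KInvStep (d := d) Lc j)) (SrecAt d Lc (toSite r) cE cVH cΛ j) κ t)) ν u) := by
  refine vertexOfK_translate (N := Lc) (fun t => shiftK_dressedStep (r := r) hLc sf sm (j + 1) t) (fun κ' u' v => ?_) ν u s
  funext x z a b
  have h := congrFun (congrFun (congrFun (congrFun (e3Sector_translate (r := r) (d := d) hLc cE cVH cΛ j κ' u' v) x) z) a) b
  simp only [shiftK] at h ⊢
  simp only [unitS_apply, h]

end Vertex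

/-! ## §3 The bond-resummed exit-face current: periodicity, boundedness -/

section Current

omit [NeZero Lc] in
/-- [folklore] **THE BOND-RESUMMED CURRENT OF A BLOCK-COVARIANT FAMILY AGAINST A PERIODIC LEG WEIGHT IS `Lc`-PERIODIC** (generic: `R (u + s) = shiftK (−Lc•s) (R u)`,
`ρ (w + Lc•s) = ρ w`; reindex `(u′, w) ↦ (u′ + s, w + Lc•s)`). -/
theorem tsum_current_periodic {R : Site (d + 1) → MKer (d + 1) (Fib d)} (hR : ∀ u s : Site (d + 1), R (u + s) = shiftK (-((Lc : ℤ) • s)) (R u))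
    {ρ : Site (d + 1) → ℝ} (hρ : ∀ w s : Site (d + 1), ρ (w + (Lc : ℤ) • s) = ρ w) (f g : Fib d) (z s : Site (d + 1)) :
    ∑' uw : Site (d + 1) × Site (d + 1), ρ uw.2 * R uw.1 (z + (Lc : ℤ) • s) uw.2 f g = ∑' uw : Site (d + 1) × Site (d + 1), ρ uw.2 * R uw.1 z uw.2 f g := by
  rw [← (Equiv.addRight ((s, (Lc : ℤ) • s) : Site (d + 1) × Site (d + 1))).tsum_eq (fun uw : Site (d + 1) × Site (d + 1) => ρ uw.2 * R uw.1 (z + (Lc : ℤ) • s) uw.2 f g)]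
  refine tsum_congr fun uw => ?_
  have e1 : z + (Lc : ℤ) • s + -((Lc : ℤ) • s) = z := by abel
  have e2 : uw.2 + (Lc : ℤ) • s + -((Lc : ℤ) • s) = uw.2 := by abel
  simp only [Equiv.coe_addRight, Prod.fst_add, Prod.snd_add, hρ, hR uw.1 s, shiftK, e1, e2]

/-- [folklore] A current identified with an `Lc`-periodic expression is bounded by its cell. -/
theorem current_bounded {T : Fin (d + 1) → Site (d + 1) → ℝ} (hT : ∀ b z s, T b (z + (Lc : ℤ) • s) = T b z) (b : Fin (d + 1)) (z : Site (d + 1)) :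
    |T b z| ≤ ∑ l, ∑ r' ∈ box (d + 1) Lc, |T l (toSite r')| :=
  (bounded_of_periodic (Lc := Lc) (V := fun y => T b y) (fun y s => hT b y s) z).trans
    (Finset.single_le_sum (f := fun l => ∑ r' ∈ box (d + 1) Lc, |T l (toSite r')|) (fun _ _ => Finset.sum_nonneg fun _ _ => abs_nonneg _) (Finset.mem_univ b))

end Current

/-! ## §4 The two words at level `j + 1` -/

section Words

variable {S' : Fin (d + 1) → Site (d + 1) → MKer (d + 1) (Fib d)} {Cs δs : ℝ} {μ ν α β : Fin (d + 1)}

/-- [folklore] **THE `S′ ⊗ S^E` DIRECT WORD AT LEVEL `j+1`, CUBIC SLOT ON THE LATTICE BOND, VANISHES BOND BY BOND WHEN THE LEVEL-`(j+1)` EXIT-FACE CURRENT IS DIVERGENCE-FREE WITH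
ZERO CELL TOTALS** (in-block root, `1 ≤ Lc`, all units, colour constants `cE cVH cΛ`, any axes, any cell bond `c`; `S′` any local stencil family with zero ff block): with
`T(b,z) = Σ'_{(u′,w)} 𝟙f(w_β)·V^E_{ν,u′} z w (inl b)(inl β)` (hypothesis `hT`), `Σ_b (T b p − T b (p − e_b)) = 0` (`hdiv`) and `Σ_{r′∈box} T b (toSite r′) = 0` (`h0`),
`Σ'_{u′} Σ'_{(y,w)} 𝟙f(y_α)𝟙f(w_β)·((P_{μ,c} ∘ X̃♮_{j+1}) ∘ V^E_{ν,u′}) y w (inl α)(inl β) = 0` — `NoFFWordCurrentKill` §1 with the kill supplied by `DressedKernelOnCurrentStep`. -/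
theorem tsum_noFF_left_E_right_word_eq_zero_succ (hLc : 1 ≤ Lc) (hr : r ∈ box (d + 1) Lc) (sf sm cE cVH cΛ : ℝ) (j : ℕ) (hS : LocStencil S' Cs δs) (hδs : 0 < δs)
    (hSff : ∀ (κ' : Fin (d + 1)) (t x z : Site (d + 1)) (α' a : Fin (d + 1)), S' κ' t x z (Sum.inl α') (Sum.inl a) = 0) (c : Site (d + 1))
    {T : Fin (d + 1) → Site (d + 1) → ℝ}
    (hT : ∀ (b : Fin (d + 1)) (z : Site (d + 1)), ∑' uw : Site (d + 1) × Site (d + 1), (if uw.2 β % (Lc : ℤ) = (Lc : ℤ) - 1 then (1 : ℝ) else 0) *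
      vertexOfK (unitK sf sm (coDressKBmAt (toSite r) Lc (KInvStep (d := d) Lc (j + 1)))) Lc
        (unitS sf sm (fun κ t => (cE * wE d Lc (j + 1)) • e3OfK Lc (coDressKBmAt (toSite r) Lc (KInvStep (d := d) Lc j)) (SrecAt d Lc (toSite r) cE cVH cΛ j) κ t)) ν uw.1 z uw.2
        (Sum.inl b) (Sum.inl β) = T b z)
    (hdiv : ∀ p : Site (d + 1), ∑ b : Fin (d + 1), (T b p - T b (p - unitVec b)) = 0) (h0 : ∀ b, ∑ r' ∈ box (d + 1) Lc, T b (toSite r') = 0) :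
    ∑' u' : Site (d + 1), ∑' yw : Site (d + 1) × Site (d + 1), (if yw.1 α % (Lc : ℤ) = (Lc : ℤ) - 1 then (1 : ℝ) else 0) * (if yw.2 β % (Lc : ℤ) = (Lc : ℤ) - 1 then (1 : ℝ) else 0) *
        comp (comp (vertexOfK (unitK sf sm (coDressKBmAt (toSite r) Lc (KInvStep (d := d) Lc (j + 1)))) Lc (unitS sf sm S') μ c)
          (unitK sf sm (coDressKBmAt (toSite r) Lc (KInvStep (d := d) Lc (j + 1)))))
          (vertexOfK (unitK sf sm (coDressKBmAt (toSite r) Lc (KInvStep (d := d) Lc (j + 1)))) Lc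
            (unitS sf sm (fun κ t => (cE * wE d Lc (j + 1)) • e3OfK Lc (coDressKBmAt (toSite r) Lc (KInvStep (d := d) Lc j)) (SrecAt d Lc (toSite r) cE cVH cΛ j) κ t)) ν u')
          yw.1 yw.2 (Sum.inl α) (Sum.inl β) = 0 := by
  classical
  -- decay data at a common rate
  obtain ⟨δK, CK, hδK, hCK, hXd⟩ := decays_coDressKBmAt_KInvStep (d := d) hr (j + 1)
  have hXu := decays_unitK (sf := sf) (sm := sm) hXd
  have hCX : 0 ≤ max |sf| |sm| * CK * max |sf| |sm| := by positivity
  obtain ⟨CE, δE, hδE, hSE⟩ := exists_locStencil_e3Sector hLc hr cE cVH cΛ j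
  have hCs : 0 ≤ Cs := (hS 0 0).nonneg (Sum.inl 0)
  have hCE : 0 ≤ CE := (hSE 0 0).nonneg (Sum.inl 0)
  set δ₁ : ℝ := min δK (min δs δE) with hδ₁
  have hδ₁0 : 0 < δ₁ := lt_min hδK (lt_min hδs hδE)
  have hX1 : Decays (unitK sf sm (coDressKBmAt (toSite r) Lc (KInvStep (d := d) Lc (j + 1)))) (max |sf| |sm| * CK * max |sf| |sm|) δ₁ :=
    decays_mono hXu hCX le_rfl (min_le_left _ _)
  have hS1 : LocStencil S' Cs δ₁ := fun κ u => biLoc_mono (hS κ u) hCs ((min_le_right _ _).trans (min_le_left _ _))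
  have hSE1 : LocStencil (fun κ t => (cE * wE d Lc (j + 1)) • e3OfK Lc (coDressKBmAt (toSite r) Lc (KInvStep (d := d) Lc j)) (SrecAt d Lc (toSite r) cE cVH cΛ j) κ t) CE δ₁ :=
    fun κ u => biLoc_mono (hSE κ u) hCE ((min_le_right _ _).trans (min_le_right _ _))
  have hV' := vertexFamily_vertexOfK (N := Lc) hX1 hCX (locStencil_unitS (sf := sf) (sm := sm) hS1) hδ₁0 le_rfl
  have hVE := vertexFamily_vertexOfK (N := Lc) hX1 hCX (locStencil_unitS (sf := sf) (sm := sm) hSE1) hδ₁0 le_rfl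
  -- periodicity and boundedness of the current
  have hTp : ∀ b z s, T b (z + (Lc : ℤ) • s) = T b z := by
    intro b z s
    rw [← hT b z, ← hT b (z + (Lc : ℤ) • s)]
    exact tsum_current_periodic (Lc := Lc) (ρ := fun w : Site (d + 1) => if w β % (Lc : ℤ) = (Lc : ℤ) - 1 then (1 : ℝ) else 0)
      (fun u s' => vertexE_translate (r := r) hLc sf sm cE cVH cΛ j ν u s') (fun w s' => face_weight_periodic Lc β w s') _ _ z s
  have h₁ : ∀ y : Site (d + 1), |(if y α % (Lc : ℤ) = (Lc : ℤ) - 1 then (1 : ℝ) else 0)| ≤ 1 := fun y => by split_ifs <;> simp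
  have h₂ : ∀ w : Site (d + 1), |(if w β % (Lc : ℤ) = (Lc : ℤ) - 1 then (1 : ℝ) else 0)| ≤ 1 := fun w => by split_ifs <;> simp
  exact tsum_noFF_left_right_word_eq_zero_of_current (N := Lc) (hV' μ c) (half_pos hδ₁0)
    (fun y z α' a => vertexOfK_unitS_noFF_inl_inl _ Lc sf sm hSff μ c y z α' a) hXu hδK (fun u' => hVE ν u') (half_pos hδ₁0)
    (fun u' z w m => vertexE_inr (r := r) sf sm cE cVH cΛ j ν u' z w m (Sum.inl β)) h₁ h₂ hT (fun b z => current_bounded (Lc := Lc) hTp b z)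
    (fun y₁ m => tsum_dressedStep_inr_mul_current hLc hr sf sm (j + 1) (fun l y s => hTp l y s) hdiv h0 y₁ m) α

/-- [folklore] **THE `S^E ⊗ S′` SWAP WORD AT LEVEL `j+1`, CUBIC SLOT ON THE LATTICE BOND (LEFT), VANISHES BOND BY BOND** under the same two properties of the current read at
the leg `inl α`, `T′(b,z) = Σ'_{(u′,y)} 𝟙f(y_α)·V^E_{ν,u′} z y (inl b)(inl α)` — `NoFFWordCurrentKill` §2: transposition through `sgnK X̃♮_{j+1}` (`trK_unitK_coDress`) and the leg
antisymmetry `trK_vertexE`. -/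
theorem tsum_E_left_noFF_right_swap_word_eq_zero_succ (hLc : 1 ≤ Lc) (hr : r ∈ box (d + 1) Lc) (sf sm cE cVH cΛ : ℝ) (j : ℕ) (hS : LocStencil S' Cs δs) (hδs : 0 < δs)
    (hSff : ∀ (κ' : Fin (d + 1)) (t x z : Site (d + 1)) (α' a : Fin (d + 1)), S' κ' t x z (Sum.inl α') (Sum.inl a) = 0) (c : Site (d + 1))
    {T' : Fin (d + 1) → Site (d + 1) → ℝ}
    (hT' : ∀ (b : Fin (d + 1)) (z : Site (d + 1)), ∑' uy : Site (d + 1) × Site (d + 1), (if uy.2 α % (Lc : ℤ) = (Lc : ℤ) - 1 then (1 : ℝ) else 0) *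
      vertexOfK (unitK sf sm (coDressKBmAt (toSite r) Lc (KInvStep (d := d) Lc (j + 1)))) Lc
        (unitS sf sm (fun κ t => (cE * wE d Lc (j + 1)) • e3OfK Lc (coDressKBmAt (toSite r) Lc (KInvStep (d := d) Lc j)) (SrecAt d Lc (toSite r) cE cVH cΛ j) κ t)) ν uy.1 z uy.2
        (Sum.inl b) (Sum.inl α) = T' b z)
    (hdiv' : ∀ p : Site (d + 1), ∑ b : Fin (d + 1), (T' b p - T' b (p - unitVec b)) = 0) (h0' : ∀ b, ∑ r' ∈ box (d + 1) Lc, T' b (toSite r') = 0) :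
    ∑' u' : Site (d + 1), ∑' yw : Site (d + 1) × Site (d + 1), (if yw.1 α % (Lc : ℤ) = (Lc : ℤ) - 1 then (1 : ℝ) else 0) * (if yw.2 β % (Lc : ℤ) = (Lc : ℤ) - 1 then (1 : ℝ) else 0) *
        comp (comp (vertexOfK (unitK sf sm (coDressKBmAt (toSite r) Lc (KInvStep (d := d) Lc (j + 1)))) Lc
            (unitS sf sm (fun κ t => (cE * wE d Lc (j + 1)) • e3OfK Lc (coDressKBmAt (toSite r) Lc (KInvStep (d := d) Lc j)) (SrecAt d Lc (toSite r) cE cVH cΛ j) κ t)) ν u')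
          (unitK sf sm (coDressKBmAt (toSite r) Lc (KInvStep (d := d) Lc (j + 1)))))
          (vertexOfK (unitK sf sm (coDressKBmAt (toSite r) Lc (KInvStep (d := d) Lc (j + 1)))) Lc (unitS sf sm S') μ c)
          yw.1 yw.2 (Sum.inl α) (Sum.inl β) = 0 := by
  classical
  obtain ⟨δK, CK, hδK, hCK, hXd⟩ := decays_coDressKBmAt_KInvStep (d := d) hr (j + 1)
  have hXu := decays_unitK (sf := sf) (sm := sm) hXd
  have hCX : 0 ≤ max |sf| |sm| * CK * max |sf| |sm| := by positivity
  obtain ⟨CE, δE, hδE, hSE⟩ := exists_locStencil_e3Sector hLc hr cE cVH cΛ j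
  have hCs : 0 ≤ Cs := (hS 0 0).nonneg (Sum.inl 0)
  have hCE : 0 ≤ CE := (hSE 0 0).nonneg (Sum.inl 0)
  set δ₁ : ℝ := min δK (min δs δE) with hδ₁
  have hδ₁0 : 0 < δ₁ := lt_min hδK (lt_min hδs hδE)
  have hX1 : Decays (unitK sf sm (coDressKBmAt (toSite r) Lc (KInvStep (d := d) Lc (j + 1)))) (max |sf| |sm| * CK * max |sf| |sm|) δ₁ :=
    decays_mono hXu hCX le_rfl (min_le_left _ _)
  have hS1 : LocStencil S' Cs δ₁ := fun κ u => biLoc_mono (hS κ u) hCs ((min_le_right _ _).trans (min_le_left _ _))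
  have hSE1 : LocStencil (fun κ t => (cE * wE d Lc (j + 1)) • e3OfK Lc (coDressKBmAt (toSite r) Lc (KInvStep (d := d) Lc j)) (SrecAt d Lc (toSite r) cE cVH cΛ j) κ t) CE δ₁ :=
    fun κ u => biLoc_mono (hSE κ u) hCE ((min_le_right _ _).trans (min_le_right _ _))
  have hV' := vertexFamily_vertexOfK (N := Lc) hX1 hCX (locStencil_unitS (sf := sf) (sm := sm) hS1) hδ₁0 le_rfl
  have hVE := vertexFamily_vertexOfK (N := Lc) hX1 hCX (locStencil_unitS (sf := sf) (sm := sm) hSE1) hδ₁0 le_rfl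
  have hTp : ∀ b z s, T' b (z + (Lc : ℤ) • s) = T' b z := by
    intro b z s
    rw [← hT' b z, ← hT' b (z + (Lc : ℤ) • s)]
    exact tsum_current_periodic (Lc := Lc) (ρ := fun w : Site (d + 1) => if w α % (Lc : ℤ) = (Lc : ℤ) - 1 then (1 : ℝ) else 0)
      (fun u s' => vertexE_translate (r := r) hLc sf sm cE cVH cΛ j ν u s') (fun w s' => face_weight_periodic Lc α w s') _ _ z s
  have h₁ : ∀ y : Site (d + 1), |(if y α % (Lc : ℤ) = (Lc : ℤ) - 1 then (1 : ℝ) else 0)| ≤ 1 := fun y => by split_ifs <;> simp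
  have h₂ : ∀ w : Site (d + 1), |(if w β % (Lc : ℤ) = (Lc : ℤ) - 1 then (1 : ℝ) else 0)| ≤ 1 := fun w => by split_ifs <;> simp
  exact tsum_left_right_noFF_swap_word_eq_zero_of_current (N := Lc) (hV' μ c) (half_pos hδ₁0)
    (fun y z α' a => vertexOfK_unitS_noFF_inl_inl _ Lc sf sm hSff μ c y z α' a) hXu hδK (trK_unitK_coDress hr (j + 1) sf sm)
    (fun u' => hVE ν u') (half_pos hδ₁0) (fun u' => trK_vertexE hLc hr sf sm cE cVH cΛ j ν u')
    (fun u' z w m => vertexE_inr (r := r) sf sm cE cVH cΛ j ν u' z w m (Sum.inl α)) h₁ h₂ hT' (fun b z => current_bounded (Lc := Lc) hTp b z)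
    (fun y₁ m => tsum_dressedStep_inr_mul_current hLc hr sf sm (j + 1) (fun l y s => hTp l y s) hdiv' h0' y₁ m) β

end Words

end Summit.QuantumFields.BalabanUV.Beta.GAN24.VHWordsZeroLatticeStep

end
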